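import Mathlib
import HarnessLib
import Summits.ValiantsHypothesis.ValiantsHypothesis.Theses.MonotoneRestoration
import Literature.Computability.AlgebraicComplexity.ArithCircuit
import Literature.Computability.AlgebraicComplexity.ArithCircuitProofs
import Literature.Computability.AlgebraicComplexity.MonotoneStructure
import Literature.Computability.AlgebraicComplexity.PermanentIrreducible
import Literature.ModelTheory.FiniteModelTheory.CkEquiv
import Summits.ValiantsHypothesis.ValiantsHypothesis.Theorems.MonotoneRestorationMonotoneRestorationQPCosetCount
import Summits.ValiantsHypothesis.ValiantsHypothesis.Theorems.MonotoneRestorationMonotoneRestorationQPSymmetricLB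
import Summits.ValiantsHypothesis.ValiantsHypothesis.Theorems.MonotoneRestorationMonotoneRestorationQPSupportSymmetrisation
import Summits.ValiantsHypothesis.ValiantsHypothesis.Theorems.MonotoneRestorationMonotoneRestorationQPSparseRegime
import Summits.ValiantsHypothesis.ValiantsHypothesis.Theorems.MonotoneRestorationMonotoneRestorationQPBeta
import Literature.Computability.AlgebraicComplexity.SymmetricArithCircuit
import Literature.Computability.AlgebraicComplexity.DawarWilsenach2025Proofs
import Literature.GroupTheory.PermutationGroups.SmallIndexSubgroups
import Summits.ValiantsHypothesis.ValiantsHypothesis.Theorems.MonotoneRestorationQP.Negative.LoadBearing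
import Summits.ValiantsHypothesis.ValiantsHypothesis.Theorems.MonotoneRestorationMonotoneRestorationQPPermSupportCount

/-! TTRL-lite variant V19048 of stmt-ValiantsHypothesis-15886

Move `small_case` (`[n4_even_false]`): the stub `stub_altFixing_orbit_dichotomy` at the boundary
`n = 4`, `X = ∅`, `|T| < 4`, with the largeness hypothesis `|X| + 9 ≤ n` dropped.  This small
case is FALSE — `Alt(Fin 4)` has the Klein four-group `V₄` of index `3 < 4` — and the negation is
proved here by an explicit witness.
-/

-- `Summit.ValiantsHypothesis.ValiantsHypothesis.…` is the tree's mandated single-conjunct layout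
-- (Sub = Summit), so the duplicated namespace component is intended.
set_option linter.dupNamespace false

namespace Summit.ValiantsHypothesis.ValiantsHypothesis.Theorems

open Summit.ValiantsHypothesis.ValiantsHypothesis.Theses.MonotoneRestoration
open Literature.Computability.AlgebraicComplexity

/-- **TTRL-lite variant V19048 of `stub_altFixing_orbit_dichotomy` is FALSE** (move `small_case`,
`n = 4`, `X = ∅`, `|T| < 4`, hypothesis `|X| + 9 ≤ n` dropped): below the Jordan gap the orbit
dichotomy fails at `n = 4`, because `Alt(Fin 4)` has a subgroup of index `3`, the Klein four-group.

Witness: `K = ℕ`, `q = x_{01} + x_{10} + x_{23} + x_{32}` (the perfect matching `{01 ∣ 23}` of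
`Fin 4`, written as a sum over its set of ordered pairs), and `T` = the three matching polynomials
(for `{01 ∣ 23}`, `{02 ∣ 13}`, `{03 ∣ 12}`), so `|T| ≤ 3 < 4` (`Finset.card_le_three`).  Every
permutation `ρ` of `Fin 4` maps the matching `{01 ∣ 23}` to one of the three matchings (a finite
check on the tuple `(ρ 0, ρ 1, ρ 2, ρ 3)`, `decide`), and `rename` of a sum of variables over a set
of pairs is the sum over the image set (`Finset.sum_image`), so the whole orbit of `q` lies in `T`;
yet the even `3`-cycle `ρ = (0 1)(1 2)` sends `q` to the `{03 ∣ 12}` polynomial, which differs from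
`q` (evaluate at the indicator of the pair `(0, 1)`: `0 ≠ 1` in `ℕ`). -/
theorem stub_altFixing_orbit_dichotomy_var19048_false :
    ¬ (∀ (K : Type) [CommSemiring K] (q : MvPolynomial (Fin 4 × Fin 4) K)
        (T : Finset (MvPolynomial (Fin 4 × Fin 4) K)), T.card < 4 →
        (∀ ρ : Equiv.Perm (Fin 4), Equiv.Perm.sign ρ = 1 →
          MvPolynomial.rename (fun p : Fin 4 × Fin 4 => (ρ p.1, ρ p.2)) q ∈ T) →
        ∀ ρ : Equiv.Perm (Fin 4), Equiv.Perm.sign ρ = 1 →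
          MvPolynomial.rename (fun p : Fin 4 × Fin 4 => (ρ p.1, ρ p.2)) q = q) := by
  intro h
  -- `P S = ∑_{p ∈ S} x_p`, kept opaque through `hP`
  obtain ⟨P, hP⟩ : ∃ P : Finset (Fin 4 × Fin 4) → MvPolynomial (Fin 4 × Fin 4) ℕ,
      ∀ S, P S = ∑ p ∈ S, MvPolynomial.X p := ⟨_, fun _ => rfl⟩
  -- relabelling a sum of variables = summing over the relabelled index set
  have hren : ∀ (ρ : Equiv.Perm (Fin 4)) (S : Finset (Fin 4 × Fin 4)),
      MvPolynomial.rename (fun p : Fin 4 × Fin 4 => (ρ p.1, ρ p.2)) (P S)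
        = P (S.image (fun p : Fin 4 × Fin 4 => (ρ p.1, ρ p.2))) := by
    intro ρ S
    rw [hP, hP, map_sum, Finset.sum_image]
    · simp only [MvPolynomial.rename_X]
    · intro x _ y _ hxy
      simp only [Prod.mk.injEq] at hxy
      exact Prod.ext (ρ.injective hxy.1) (ρ.injective hxy.2)
  -- the finite combinatorial core: a bijection of `Fin 4` permutes the three perfect matchings
  have key : ∀ a b c d : Fin 4, a ≠ b → a ≠ c → a ≠ d → b ≠ c → b ≠ d → c ≠ d →
      ({(a, b), (b, a), (c, d), (d, c)} : Finset (Fin 4 × Fin 4)) = {(0, 1), (1, 0), (2, 3), (3, 2)} ∨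
      ({(a, b), (b, a), (c, d), (d, c)} : Finset (Fin 4 × Fin 4)) = {(0, 2), (2, 0), (1, 3), (3, 1)} ∨
      ({(a, b), (b, a), (c, d), (d, c)} : Finset (Fin 4 × Fin 4)) = {(0, 3), (3, 0), (1, 2), (2, 1)} := by
    decide
  have himg : ∀ ρ : Equiv.Perm (Fin 4),
      ({(0, 1), (1, 0), (2, 3), (3, 2)} : Finset (Fin 4 × Fin 4)).image
          (fun p : Fin 4 × Fin 4 => (ρ p.1, ρ p.2)) = {(0, 1), (1, 0), (2, 3), (3, 2)} ∨
      ({(0, 1), (1, 0), (2, 3), (3, 2)} : Finset (Fin 4 × Fin 4)).image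
          (fun p : Fin 4 × Fin 4 => (ρ p.1, ρ p.2)) = {(0, 2), (2, 0), (1, 3), (3, 1)} ∨
      ({(0, 1), (1, 0), (2, 3), (3, 2)} : Finset (Fin 4 × Fin 4)).image
          (fun p : Fin 4 × Fin 4 => (ρ p.1, ρ p.2)) = {(0, 3), (3, 0), (1, 2), (2, 1)} := by
    intro ρ
    have hne : ∀ i j : Fin 4, i ≠ j → ρ i ≠ ρ j := fun i j hij hρ => hij (ρ.injective hρ)
    simp only [Finset.image_insert, Finset.image_singleton]
    exact key _ _ _ _ (hne 0 1 (by decide)) (hne 0 2 (by decide)) (hne 0 3 (by decide))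
      (hne 1 2 (by decide)) (hne 1 3 (by decide)) (hne 2 3 (by decide))
  -- hence the whole `Sym(Fin 4)`-orbit of `q = P {01|23}` lies in the three-element set `T`
  have hmem : ∀ ρ : Equiv.Perm (Fin 4), Equiv.Perm.sign ρ = 1 →
      MvPolynomial.rename (fun p : Fin 4 × Fin 4 => (ρ p.1, ρ p.2))
          (P {(0, 1), (1, 0), (2, 3), (3, 2)}) ∈
        ({P {(0, 1), (1, 0), (2, 3), (3, 2)}, P {(0, 2), (2, 0), (1, 3), (3, 1)},
          P {(0, 3), (3, 0), (1, 2), (2, 1)}} : Finset (MvPolynomial (Fin 4 × Fin 4) ℕ)) := by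
    intro ρ _
    rw [hren]
    rcases himg ρ with h1 | h2 | h3
    · rw [h1]; simp
    · rw [h2]; simp
    · rw [h3]; simp
  have hcard : ({P {(0, 1), (1, 0), (2, 3), (3, 2)}, P {(0, 2), (2, 0), (1, 3), (3, 1)},
      P {(0, 3), (3, 0), (1, 2), (2, 1)}} : Finset (MvPolynomial (Fin 4 × Fin 4) ℕ)).card < 4 :=
    lt_of_le_of_lt Finset.card_le_three (by norm_num)
  -- the even `3`-cycle `(0 1)(1 2)`
  have hsign : Equiv.Perm.sign (Equiv.swap (0 : Fin 4) 1 * Equiv.swap 1 2 : Equiv.Perm (Fin 4)) = 1 := by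
    rw [Equiv.Perm.sign_mul, Equiv.Perm.sign_swap (by decide), Equiv.Perm.sign_swap (by decide)]
    exact Int.units_mul_self _
  have himg₀ : ({(0, 1), (1, 0), (2, 3), (3, 2)} : Finset (Fin 4 × Fin 4)).image
      (fun p : Fin 4 × Fin 4 => ((Equiv.swap (0 : Fin 4) 1 * Equiv.swap 1 2 : Equiv.Perm (Fin 4)) p.1,
        (Equiv.swap (0 : Fin 4) 1 * Equiv.swap 1 2 : Equiv.Perm (Fin 4)) p.2)) =
        {(0, 3), (3, 0), (1, 2), (2, 1)} := by
    decide
  -- specialise the (false) statement to the witness: the `3`-cycle would fix `q`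
  have hfix := h ℕ _ _ hcard hmem _ hsign
  rw [hren, himg₀, hP, hP] at hfix
  -- evaluate both sides at the indicator of the pair `(0, 1)`: `0 = 1` in `ℕ`
  have hev := congrArg
    (MvPolynomial.eval (fun p : Fin 4 × Fin 4 => if p = ((0 : Fin 4), (1 : Fin 4)) then (1 : ℕ) else 0))
    hfix
  simp [MvPolynomial.eval_X] at hev

end Summit.ValiantsHypothesis.ValiantsHypothesis.Theorems
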